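import Summits.AtomisticToContinuum.FouriersLaw.Theorems.HiddenChargeMazurOpenMazurBridgeThomson

/-!
# `HiddenChargeMazur.OpenMazurBridge` from `DressedCharge` alone (item stmt-AtomisticToContinuum-13513)

Route `HiddenChargeMazur` (sub-problem `FouriersLaw`, summit `AtomisticToContinuum`), support item
stmt-AtomisticToContinuum-13513 `OpenMazurBridge` (THE INSTRUMENT: an odd local polynomial charge with
extensive current overlap at a positive parameter point forbids `FouriersLawFor` there). The route derives it
as `BridgeGlue : StaticKubo → ThomsonBound → DressedCharge → OpenMazurBridge`. This file proves the
stronger reduction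

  `openMazurBridge_of_dressedCharge : DressedCharge → OpenMazurBridge`,

i.e. the instrument is CONDITIONAL ON THE SINGLE CRUX `DressedCharge` (stmt-AtomisticToContinuum-13509):
the two other bridge items are replaced by theorems already in the tree —

* `StaticKubo` (stmt-13510) by the PROVED Kundu–Dhar–Narayan open-chain Green–Kubo identity
  `(N-1) T² D_N = ∫₀^∞ ⟨J, P_t J⟩_{μ_T} dt` (`HonestZwanzig.OpenChainGreenKubo`, `openChainGreenKubo_holds`,
  through `Corrector.greenKubo_of_openChainGreenKubo`), the smooth Kubo corrector `u` with `L_{T,T} u = -J`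
  (`Corrector.corrector_smooth`, Hörmander), `⟨u, J⟩ = Z ∫₀^∞⟨J, P_tJ⟩`
  (`pinnedChain_integral_corrector_mul_withDensity`) and the tap energy identity
  `γ T Σ_b ‖∂_{p_b} u‖² = ⟨u, J⟩` (`Corrector.integral_mul_source_eq_dirichlet`). No pointwise GRADIENT bound on
  `u` is needed: `∂_{p_b} u ∈ L²(e^{-H/T})` suffices because the dressed side is of class `e^{θH}`,
  `θ < 1/(2T)` (the route's normalisation);
* `ThomsonBound` (stmt-13512) by the integration by parts `∫ J G ρ = T Σ_b ∫ ∂_{p_b}u (w_b + γ ∂_{p_b}G) ρ`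
  for DRESSED `G` (`integral_source_mul_dressed`: the energy-cutoff Green calculus of
  `JunctionLocalitySuperadditiveResistanceKubo*` — antisymmetry of `X_H`, the two-tap Dirichlet form, and the
  creation operators `∂*_{p_b} = -∂_{p_b} + p_b/T` moved onto `χ_n u` — then `n → ∞`) and Cauchy–Schwarz
  (`sq_pairing_le_greenKubo_mul_leak`: `γ (∫ J G dμ_T)² ≤ (N-1)T² D_N · T Σ_b ∫ (γ∂_{p_b}G + w_b)² dμ_T`).

Then `FouriersLawFor` (uniqueness + a convergent, hence bounded, response sequence `D_N → κ(T)`) and the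
`DressedCharge` conclusion (`∫ J G ≥ cN`, leak `≤ C(1+γ²)`) give `γ c² N² ≤ (N-1) T² M C (1+γ²)` — absurd.

No definitions, no named facts, no `sorry`; the result is conditional on the route decl `DressedCharge` only.
-/

noncomputable section

open MeasureTheory Filter Topology ProbabilityTheory
open scoped ContDiff NNReal ENNReal
open Literature.MathematicalPhysics.KineticTheory.HeatConduction
open Summit.AtomisticToContinuum.FouriersLaw.Theorems.SuperadditiveResistance.DeviceLiouville
open Summit.AtomisticToContinuum.FouriersLaw.Theorems.SuperadditiveResistance.Kubo
open Summit.AtomisticToContinuum.FouriersLaw.Theorems.OddSectorIrreversibility.Corrector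

namespace Summit.AtomisticToContinuum.FouriersLaw.Theorems.HiddenChargeMazur


/-- **`OpenMazurBridge` from `DressedCharge` alone** (route `HiddenChargeMazur`, item
stmt-AtomisticToContinuum-13513, conditional on the crux stmt-AtomisticToContinuum-13509 only): if the
odd local charge at `(ω₂, lam, β, γ, T)` can be dressed (the conclusion of `DressedCharge`: `G, w_L, w_R ∈ C²`
of `e^{θH}` class, `θ < 1/(2T)`, `X_H G = T Σ_b ∂*_{p_b} w_b`, current overlap `∫ J G dμ_T ≥ cN`, leak
`T Σ_b ∫ (γ∂_{p_b}G + w_b)² dμ_T ≤ C(1+γ²)` for `N ≥ N₀`), then Fourier's law fails for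
`pinnedChain ω₂ lam β γ`: under `FouriersLawFor`, clause (i) gives weak-NESS uniqueness and a steady-state
family, clause (ii) a convergent — hence eventually bounded, `D_N ≤ M` — response sequence; the
Mazur–Thomson bound `sq_pairing_le_greenKubo_mul_leak` (whose Green–Kubo side is the tree's PROVED
Kundu–Dhar–Narayan identity `(N-1)T² D_N = ∫₀^∞⟨J, P_tJ⟩`, replacing the route's `StaticKubo`, and whose
integration by parts replaces `ThomsonBound`) gives `γ c² N² ≤ (N-1) T² M C (1+γ²)`, absurd for large `N`.
[cite: KunduDharNarayan2009, p. 3] [cite: Mazur1969] [cite: Prosen2011] -/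
theorem openMazurBridge_of_dressedCharge
    (hD : Summit.AtomisticToContinuum.FouriersLaw.Theses.HiddenChargeMazur.DressedCharge) :
    Summit.AtomisticToContinuum.FouriersLaw.Theses.HiddenChargeMazur.OpenMazurBridge := by
  intro ω₂ lam β γ T hω hl hβ hγ hT P hP hcharge hFL
  obtain ⟨c, C, hc, N₀, hdress⟩ := hD ω₂ lam β γ T hω hl hβ hγ hT P hP hcharge
  subst hP
  obtain ⟨hexu, κ, hκ, hresp⟩ := hFL
  -- clause (i): uniqueness and a steady-state family
  have huniq : ∀ (N : ℕ) (T_L T_R : ℝ), 0 < T_L → 0 < T_R →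
      ∀ μ ν : Measure (PhaseSpace N), (pinnedChain ω₂ lam β γ).IsSteadyState N T_L T_R μ →
        (pinnedChain ω₂ lam β γ).IsSteadyState N T_L T_R ν → μ = ν := by
    intro N T_L T_R hL hR μ ν hμ hν
    obtain ⟨μ₀, -, hμ₀⟩ := hexu N T_L T_R hL hR
    rw [hμ₀ μ hμ, hμ₀ ν hν]
  classical
  let μf : (N : ℕ) → ℝ → ℝ → Measure (PhaseSpace N) := fun N T_L T_R =>
    if h : 0 < T_L ∧ 0 < T_R then (hexu N T_L T_R h.1 h.2).choose else 0
  have hμf : ∀ (N : ℕ) (T_L T_R : ℝ), 0 < T_L → 0 < T_R →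
      (pinnedChain ω₂ lam β γ).IsSteadyState N T_L T_R (μf N T_L T_R) := by
    intro N T_L T_R hL hR
    simp only [μf, dif_pos (And.intro hL hR)]
    exact (hexu N T_L T_R hL hR).choose_spec.1
  -- clause (ii): the response sequence converges, hence is eventually bounded
  obtain ⟨D, hDlim, hDconv⟩ := hresp μf hμf T hT
  set M : ℝ := κ T + 1 with hM
  have hMpos : 0 < M := by have := hκ T hT; linarith
  have hDev : ∀ᶠ N : ℕ in atTop, D N < M := hDconv.eventually (gt_mem_nhds (lt_add_one (κ T)))
  have hthr : ∀ᶠ N : ℕ in atTop, T ^ 2 * M * (C * (1 + γ ^ 2)) < γ * c ^ 2 * (N : ℝ) :=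
    (tendsto_natCast_atTop_atTop.const_mul_atTop (by positivity : 0 < γ * c ^ 2)).eventually_gt_atTop _
  obtain ⟨N, hN₀, hN2, hDN, hNthr⟩ := ((eventually_ge_atTop N₀).and ((eventually_ge_atTop 2).and
    (hDev.and hthr))).exists
  have hN : 0 < N := by omega
  -- the dressed test functions at length `N`
  obtain ⟨G, wL, wR, hG, hwL, hwR, ⟨C', θ, hθ, hgrowth⟩, hXG, hover, hleak⟩ := hdress N hN₀
  -- the Mazur–Thomson bound
  have h4 := sq_pairing_le_greenKubo_mul_leak hω hl hβ hγ hT hN huniq μf hμf (hDlim N) hG hwL hwR hθ hgrowth hXG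
  rw [← OscillatorChain.gibbsMeasure_eq] at hover hleak
  have hleakγ := hleak γ
  -- bookkeeping: `γ c² N² ≤ γ (∫ J G)² ≤ (N-1) T² D_N · leak ≤ (N-1) T² M · C(1+γ²) < N · T² M C(1+γ²)`
  set I := ∫ z, (∑ i : Fin N, (pinnedChain ω₂ lam β γ).bondCurrent N i z) * G z
    ∂((pinnedChain ω₂ lam β γ).gibbsMeasure N T) with hI
  set Lk := T * ∑ i : Fin N, ((if i.val = 0 then ∫ z, (γ * partialP i G z + wL z) ^ 2
      ∂((pinnedChain ω₂ lam β γ).gibbsMeasure N T) else 0) +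
    (if i.val = N - 1 then ∫ z, (γ * partialP i G z + wR z) ^ 2
      ∂((pinnedChain ω₂ lam β γ).gibbsMeasure N T) else 0)) with hLk
  have hLk0 : 0 ≤ Lk := by
    rw [hLk]
    refine mul_nonneg hT.le (Finset.sum_nonneg fun i _ => add_nonneg ?_ ?_)
    · split_ifs
      · exact integral_nonneg fun z => sq_nonneg _
      · exact le_rfl
    · split_ifs
      · exact integral_nonneg fun z => sq_nonneg _
      · exact le_rfl
  clear_value I Lk
  have hcN : 0 < c * (N : ℝ) := by positivity
  have hI0 : 0 ≤ I := hcN.le.trans hover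
  have s1 : γ * (c * (N : ℝ)) ^ 2 ≤ γ * I ^ 2 := by
    have : (c * (N : ℝ)) ^ 2 ≤ I ^ 2 := pow_le_pow_left₀ hcN.le hover 2
    exact mul_le_mul_of_nonneg_left this hγ.le
  have hNm1 : (0 : ℝ) < (N : ℝ) - 1 := by
    have : (2 : ℝ) ≤ N := by exact_mod_cast hN2
    linarith
  have hpos : 0 < ((N : ℝ) - 1) * T ^ 2 * D N * Lk := lt_of_lt_of_le (by positivity) (s1.trans h4)
  have hDpos : 0 < D N := by
    refine lt_of_not_ge fun hle => ?_
    have : ((N : ℝ) - 1) * T ^ 2 * D N * Lk ≤ 0 :=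
      mul_nonpos_of_nonpos_of_nonneg (mul_nonpos_of_nonneg_of_nonpos (by positivity) hle) hLk0
    linarith
  have hLkpos : 0 < Lk := by
    rcases hLk0.lt_or_eq with h | h
    · exact h
    · rw [← h, mul_zero] at hpos; exact absurd hpos (lt_irrefl _)
  have hCpos : 0 < C * (1 + γ ^ 2) := hLkpos.trans_le hleakγ
  have s3 : ((N : ℝ) - 1) * T ^ 2 * D N * Lk ≤ ((N : ℝ) - 1) * T ^ 2 * M * (C * (1 + γ ^ 2)) := by
    have h1 : ((N : ℝ) - 1) * T ^ 2 * D N * Lk ≤ ((N : ℝ) - 1) * T ^ 2 * M * Lk :=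
      mul_le_mul_of_nonneg_right (mul_le_mul_of_nonneg_left hDN.le (by positivity)) hLk0
    have h2 : ((N : ℝ) - 1) * T ^ 2 * M * Lk ≤ ((N : ℝ) - 1) * T ^ 2 * M * (C * (1 + γ ^ 2)) :=
      mul_le_mul_of_nonneg_left hleakγ (by positivity)
    exact h1.trans h2
  have s4 : ((N : ℝ) - 1) * T ^ 2 * M * (C * (1 + γ ^ 2)) < (N : ℝ) * (T ^ 2 * M * (C * (1 + γ ^ 2))) := by
    have : ((N : ℝ) - 1) * T ^ 2 * M * (C * (1 + γ ^ 2)) = ((N : ℝ) - 1) * (T ^ 2 * M * (C * (1 + γ ^ 2))) := by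
      ring
    rw [this]
    exact mul_lt_mul_of_pos_right (by linarith) (by positivity)
  have s5 : (N : ℝ) * (T ^ 2 * M * (C * (1 + γ ^ 2))) < (N : ℝ) * (γ * c ^ 2 * (N : ℝ)) :=
    mul_lt_mul_of_pos_left hNthr (by exact_mod_cast hN)
  have s6 : (N : ℝ) * (γ * c ^ 2 * (N : ℝ)) = γ * (c * (N : ℝ)) ^ 2 := by ring
  linarith [s1.trans h4]

end Summit.AtomisticToContinuum.FouriersLaw.Theorems.HiddenChargeMazur

end
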